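import Summits.CriticalPhenomena.SAWScalingLimit.Theorems.ObservableToSLE.Negative.Identification
import HarnessLib

/-!
# Crux `SAWDevelopingMap.ObservableToSLE` (stmt-CriticalPhenomena-10472), line
`floor-ratio-restriction-bootstrap`, stub `stub_canonicalTransfer`: compact connected cores of a
domain (continuum input of the exhaustion of compacts in the inner admissible discretisation (M1))

Landing target:
`Summits/CriticalPhenomena/SAWScalingLimit/Theorems/SAWDevelopingMapObservableToSLECanonicalTransferCompactCore.lean`
(`--supports stmt-CriticalPhenomena-10472`).

The inner admissible family of (M1) is the (filled) main lattice component of the vertices whose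
`3√δ`-disc lies in the domain; that it eventually contains every lattice vertex of a given compact
`K ⊆ D` ("exhaustion of the compacts") is the lattice shadow (`…CanonicalTransferLatticeChains`,
walks along preconnected sets) of the following continuum fact, proved here:

* `exists_compact_connected_core` = registered sub-goal `stub_canonicalTransfer_compactCore` — **in
  an open connected `U ⊆ ℂ`, every compact `K ⊆ U` and point `x₀ ∈ U` lie in a compact connected
  `S ⊆ U`** (finitely many paths from `x₀` to the centres of a cover of `K` by discs compactly
  inside `U`, together with those discs); consequently `S` has a closed `ε`-neighbourhood inside
  `U` (`exists_compact_connected_core_cthickening`).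
-/

noncomputable section

open scoped Topology
open Filter Set Metric

namespace Summit.CriticalPhenomena.SAWScalingLimit.Theorems.ObservableToSLE.FloorRatio

/-- **Compact connected cores** (named form of the registered sub-goal
`stub_canonicalTransfer_compactCore`): in an open connected `U ⊆ ℂ`, a compact `K ⊆ U` and a point
`x₀ ∈ U` are contained in a compact connected `S ⊆ U`. [folklore] -/
theorem exists_compact_connected_core {U K : Set ℂ} (hU : IsOpen U) (hUc : IsConnected U)
    (hK : IsCompact K) (hKU : K ⊆ U) {x₀ : ℂ} (hx₀ : x₀ ∈ U) :
    ∃ S : Set ℂ, K ⊆ S ∧ x₀ ∈ S ∧ S ⊆ U ∧ IsCompact S ∧ IsConnected S := by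
  have hpc : IsPathConnected U := hU.isConnected_iff_isPathConnected.1 hUc
  -- discs compactly inside `U`
  have hdisc : ∀ k ∈ U, ∃ r > 0, closedBall k r ⊆ U := fun k hk => by
    obtain ⟨ε, hε, hεU⟩ := Metric.isOpen_iff.1 hU k hk
    exact ⟨ε / 2, half_pos hε, closedBall_subset_ball (half_lt_self hε) |>.trans hεU⟩
  choose! r hr hrU using hdisc
  -- a finite cover of `K`
  obtain ⟨t, htK, hKt⟩ := hK.elim_nhds_subcover (fun k => ball k (r k))
    fun k hk => ball_mem_nhds k (hr k (hKU hk))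
  -- paths from `x₀`
  have hpath : ∀ k ∈ t, ∃ γ : Path x₀ k, ∀ s, γ s ∈ U := fun k hk =>
    ⟨(hpc.joinedIn x₀ hx₀ k (hKU (htK k hk))).somePath,
      (hpc.joinedIn x₀ hx₀ k (hKU (htK k hk))).somePath_mem⟩
  choose γ hγ using hpath
  -- the core
  refine ⟨closedBall x₀ (r x₀) ∪ ⋃ k, ⋃ (hk : k ∈ t), (range (γ k hk) ∪ closedBall k (r k)),
    ?_, ?_, ?_, ?_, ?_⟩
  · intro z hz
    obtain ⟨k, hk, hzk⟩ := mem_iUnion₂.1 (hKt hz)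
    exact Or.inr (mem_iUnion₂.2 ⟨k, hk, Or.inr (ball_subset_closedBall hzk)⟩)
  · exact Or.inl (mem_closedBall_self (hr x₀ hx₀).le)
  · refine union_subset (hrU x₀ hx₀) (iUnion₂_subset fun k hk => union_subset ?_ ?_)
    · rintro _ ⟨s, rfl⟩; exact hγ k hk s
    · exact hrU k (hKU (htK k hk))
  · refine (isCompact_closedBall x₀ (r x₀)).union ?_
    have : (⋃ k, ⋃ (hk : k ∈ t), (range (γ k hk) ∪ closedBall k (r k))) =
        ⋃ k : {k // k ∈ t}, (range (γ k.1 k.2) ∪ closedBall k.1 (r k.1)) := by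
      ext z; simp only [mem_iUnion, Subtype.exists]
    rw [this]
    exact isCompact_iUnion fun k =>
      (isCompact_range (γ k.1 k.2).continuous).union (isCompact_closedBall _ _)
  · refine ⟨⟨x₀, Or.inl (mem_closedBall_self (hr x₀ hx₀).le)⟩, ?_⟩
    -- every piece is preconnected and contains `x₀`
    have hpiece : ∀ k (hk : k ∈ t), IsPreconnected (range (γ k hk) ∪ closedBall k (r k)) ∧
        x₀ ∈ range (γ k hk) ∪ closedBall k (r k) := fun k hk =>
      ⟨IsPreconnected.union k ⟨1, (γ k hk).target⟩ (mem_closedBall_self (hr k (hKU (htK k hk))).le)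
          (isConnected_range (γ k hk).continuous).isPreconnected
          (convex_closedBall k (r k)).isPreconnected,
        Or.inl ⟨0, (γ k hk).source⟩⟩
    have heq : (⋃ k, ⋃ (hk : k ∈ t), (range (γ k hk) ∪ closedBall k (r k))) =
        ⋃ k : {k // k ∈ t}, (range (γ k.1 k.2) ∪ closedBall k.1 (r k.1)) := by
      ext z; simp only [mem_iUnion, Subtype.exists]
    by_cases ht : t.Nonempty
    · haveI : Nonempty {k // k ∈ t} := ht.to_subtype
      have hU2 : IsPreconnected (⋃ k : {k // k ∈ t}, (range (γ k.1 k.2) ∪ closedBall k.1 (r k.1))) :=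
        isPreconnected_iUnion ⟨x₀, mem_iInter.2 fun k => (hpiece k.1 k.2).2⟩
          fun k => (hpiece k.1 k.2).1
      obtain ⟨k, hk⟩ := ht
      rw [heq]
      exact IsPreconnected.union x₀ (mem_closedBall_self (hr x₀ hx₀).le)
        (mem_iUnion.2 ⟨⟨k, hk⟩, (hpiece k hk).2⟩) (convex_closedBall x₀ (r x₀)).isPreconnected hU2
    · rw [Finset.not_nonempty_iff_eq_empty] at ht
      subst ht
      simpa using (convex_closedBall x₀ (r x₀)).isPreconnected

/-- **Compact connected cores with a collar**: in an open connected `U ⊆ ℂ`, a compact `K ⊆ U`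
and `x₀ ∈ U` lie in a compact connected `S` whose closed `ε`-neighbourhood is still inside `U`
for some `ε > 0`. [folklore] -/
theorem exists_compact_connected_core_cthickening {U K : Set ℂ} (hU : IsOpen U)
    (hUc : IsConnected U) (hK : IsCompact K) (hKU : K ⊆ U) {x₀ : ℂ} (hx₀ : x₀ ∈ U) :
    ∃ (S : Set ℂ) (ε : ℝ), 0 < ε ∧ K ⊆ S ∧ x₀ ∈ S ∧ IsCompact S ∧ IsConnected S ∧
      cthickening ε S ⊆ U := by
  obtain ⟨S, hKS, hx₀S, hSU, hSc, hSconn⟩ := exists_compact_connected_core hU hUc hK hKU hx₀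
  obtain ⟨ε, hε, hεU⟩ := hSc.exists_cthickening_subset_open hU hSU
  exact ⟨S, ε, hε, hKS, hx₀S, hSc, hSconn, hεU⟩

/-- **Registered sub-goal `stub_canonicalTransfer_compactCore`** (crux item stmt-CriticalPhenomena-10472,
line `floor-ratio-restriction-bootstrap`, stub `stub_canonicalTransfer`): compact connected cores
with a collar, registry form of `exists_compact_connected_core_cthickening`. [folklore] -/
theorem stub_canonicalTransfer_compactCore :
    ∀ (U K : Set ℂ) (x₀ : ℂ), IsOpen U → IsConnected U → IsCompact K → K ⊆ U → x₀ ∈ U →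
    ∃ (S : Set ℂ) (ε : ℝ), 0 < ε ∧ K ⊆ S ∧ x₀ ∈ S ∧ IsCompact S ∧ IsConnected S ∧
      cthickening ε S ⊆ U :=
  fun _ _ _ hU hUc hK hKU hx₀ => exists_compact_connected_core_cthickening hU hUc hK hKU hx₀

end Summit.CriticalPhenomena.SAWScalingLimit.Theorems.ObservableToSLE.FloorRatio

end
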